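import Summits.BirchSwinnertonDyer.BirchSwinnertonDyer.Theorems.ByReductionTypeAtTwoOrdKatoHalfAtTwoIsoPosDiscEpsilonDefs
import Summits.BirchSwinnertonDyer.BirchSwinnertonDyer.Theorems.ByReductionTypeAtTwoAdditiveKatoFineConjAPointFieldI
import HarnessLib

/-!
# Route ByReductionTypeAtTwo, crux `OrdKatoHalfAtTwoIso` (stmt-BirchSwinnertonDyer-19573), child PAIR
# `OrdKatoFineZetaAtTwoResidue` (stmt-BirchSwinnertonDyer-24097), line `steinberg-fibre-at-two`: Q⁺ (Coates–Sujatha (A) at `2` on the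
# cell [`ρ̄₂` onto ∧ `0 < Δ`]) from Iwasawa's `μ₂ = 0` on the SMALL carrier `ℚ(P, √−1)` — the cubic `2`-torsion point field with `√−1`
# adjoined (degree `6`) — instead of Iw⁺'s dodecic `ℚ(W[2], √−1)` (theorems only)

Seat `cruxlead-stmt-BirchSwinnertonDyer-19573` g7 (LEAD PROVER, MODE LINE; HOME `run/shared/lean/pub/bsd-2adic/`; crux-triage r1-2
s81 «smaller carrier `ℚ(e₁, i)`», lead g6 HANDOFF typer ask). HONEST FRAMING (cell bsd-2adic): BSD is not proved by any of this; the
crux, its PAIR child 24097 and Q⁺ are NOT proved here; THEOREMS ONLY, each CONDITIONAL on the PRINT facts it names (`hLim2` = Lim 2017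
Thm. 3.5 with Lemma 3.2 at `p = 2`; `hFuk` = Fukuda 1994 Thm. 1 (2)) and on the displayed classical `μ₂ = 0` input. No definition, no
`sorry`, nothing asserted.

WHY. Skeleton v15's displayed supply road for the research stub Q⁺ (`FineSelmerConjATwoOrdPosDisc`) is lead g6's
`fineSelmerConjATwoOrdPosDisc_of_lim_of_classicalMu` over addL2x's `conjA_two_of_classicalMu_divisionField_two_adjoin_I`: the carrier
of the classical `μ₂ = 0` input (Iw⁺, `ClassicalMuTwoDivisionFieldAdjoinIOrdPosDisc`) is `ℚ(W[2], √−1)`, of degree `12` on the cell. The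
Lim@2 fact's scope rider (`FineSelmerClassGroupCriterion.lean` :448–461) names the honest SMALL witness «`L := ℚ(e₁, i) ≤ ℚ(E[4])`
(index `2^{k−1}`; totally imaginary)», and addL2x GEN 9 supplied it for every curve (`AddKatoTwo.conjA_two_of_classicalMu_pointField_adjoin_I`,
`…_of_fukudaCertificate_pointField_adjoin_I`: `ℚ(P, i) ≤ ℚ(E[4])` with `2`-power index for every non-zero `P ∈ E[2]`). This file is
the cell-level door: Q⁺ follows from `μ₂ = 0` for the cyclotomic `ℤ₂`-extensions of the sextic CM-like field `ℚ(P, i)` at ONE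
non-zero `2`-torsion point `P` of each cell curve (on the cell `ℚ(P)` is a totally real non-Galois cubic, `ℚ(P, i)` its totally
imaginary quadratic extension) — per curve, from TWO class groups of degree-`6·2ⁿ` fields (Fukuda) instead of degree-`12·2ⁿ` ones.

* `fineSelmerConjATwoOrdPosDisc_of_lim_of_classicalMu_pointField_adjoin_I` — Q⁺ ⟸ Lim@2 + «∀ cell `W` ∃ `P ≠ 0` in `W[2]`, `i² = −1`:
  `μ₂ = 0` along every cyclotomic `ℤ₂`-extension of `ℚ(P, i)`»;
* `fineSelmerConjATwoOrdPosDisc_of_lim_of_fukudaCertificate_pointField_adjoin_I` — Q⁺ ⟸ Lim@2 + Fukuda 1994 Thm. 1 (2) + per-curve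
  two-layer class-group certificates on `ℚ(P, i)`;
(The per-curve instance is addL2x's `AddKatoTwo.conjA_two_of_classicalMu_pointField_adjoin_I` itself — not restated.)

References: [Lim2017FineSelmer] §3 Thm. 3.5, Lemma 3.2; [CoatesSujatha2005] Conj. A, Thm. 3.4; [Fukuda1994] Thm. 1 (2), p. 264;
[Iwasawa1973MuInvariants] §1; tree p699544 (`…PosDiscEpsilonDefs`), `…AdditiveKatoFineConjAPointFieldI` (addL2x GEN 9).
-/

set_option autoImplicit false
set_option linter.dupNamespace false

noncomputable section

open scoped Classical
open WeierstrassCurve Field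
open Literature.NumberTheory.EllipticCurves Literature.NumberTheory.EllipticCurves.Rank1Residual
open Literature.NumberTheory.IwasawaTheory
open Summit.BirchSwinnertonDyer.BirchSwinnertonDyer.Theorems.AddKatoTwo

namespace Summit.BirchSwinnertonDyer.BirchSwinnertonDyer.Theorems.SteinbergFibreAtTwo

/-- **Q⁺ `FineSelmerConjATwoOrdPosDisc` from Lim@2 and Iwasawa's `μ₂ = 0` on the SMALL carrier**: for every curve of the cell [non-CM,
analytic rank `0`, good ordinary at `2`, `ρ̄₂` onto, `0 < Δ`] SOME non-zero `P ∈ W[2]` and SOME `i` with `i² = −1` such that every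
cyclotomic `ℤ₂`-extension of `ℚ(P, i)` (degree `6`, totally imaginary) has classical `μ = 0`. Carrier hypotheses of Lim's theorem are
discharged by addL2x GEN 9. CONDITIONAL on `hLim2` (print) and the displayed `μ₂ = 0` input (Iwasawa's conjecture on a non-abelian
family — OPEN); nothing closed. [cite: Lim2017FineSelmer, §3 Thm. 3.5 and Lemma 3.2] [cite: CoatesSujatha2005, Conj. A and Thm. 3.4]
[cite: Iwasawa1973MuInvariants, §1 (shape only)] -/
theorem fineSelmerConjATwoOrdPosDisc_of_lim_of_classicalMu_pointField_adjoin_I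
    (hLim2 : Lim2017.thm35_at_two_fineSelmerDual_moduleFinite_of_classicalMuVanishes_of_le_divisionField_four)
    (hIw : ∀ (W : WeierstrassCurve ℚ) [W.IsElliptic] [W.IsGloballyMinimal], ¬ W.HasCM → W.analyticRank = 0 →
      GoodOrd W 2 → W.HasSurjectiveModNGaloisRep 2 → 0 < W.Δ →
      ∃ (P : geomTorsion W 2) (i : AlgebraicClosure ℚ), P ≠ 0 ∧ i ^ 2 = -1 ∧
        ∀ κL : ZpExtension
            ↥(IntermediateField.fixedField (MulAction.stabilizer (absoluteGaloisGroup ℚ) P) ⊔ IntermediateField.adjoin ℚ {i}) 2,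
          κL.IsCyclotomic → ClassicalMuVanishes κL) :
    FineSelmerConjATwoOrdPosDisc := by
  intro W _ _ hcm hr hgo h2 hΔ κ hκ
  obtain ⟨P, i, hP, hi, hμ⟩ := hIw W hcm hr hgo h2 hΔ
  exact conjA_two_of_classicalMu_pointField_adjoin_I hLim2 W hP hi hμ κ hκ

/-- **Q⁺ from Lim@2, Fukuda 1994 Thm. 1 (2) and per-curve TWO-LAYER CLASS-GROUP CERTIFICATES on the small carrier**: for every curve of
the cell SOME non-zero `P ∈ W[2]`, SOME `i` (`i² = −1`) and a layer `n₀` such that every cyclotomic `ℤ₂`-tower of `ℚ(P, i)` is totally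
ramified from `n₀` with equal `2`-ranks of the class groups at layers `n₀`, `n₀ + 1` (degrees `6·2^{n₀}` / `12·2^{n₀}`). CONDITIONAL on
`hLim2`, `hFuk` (print) and the certificates (decidable data, one pair of class groups per curve — kit/eng work, e.g. `bnfinit`
+ `bnfcertify`); nothing closed; the `∀ W` makes it a supply road, not a proof. [cite: Fukuda1994, Thm. 1 (2), p. 264]
[cite: Lim2017FineSelmer, §3 Thm. 3.5 and Lemma 3.2] [cite: CoatesSujatha2005, statement (A)] -/
theorem fineSelmerConjATwoOrdPosDisc_of_lim_of_fukudaCertificate_pointField_adjoin_I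
    (hLim2 : Lim2017.thm35_at_two_fineSelmerDual_moduleFinite_of_classicalMuVanishes_of_le_divisionField_four)
    (hFuk : fukuda1994_thm1_classGroupPRank_const_of_succ_eq)
    (hcert : ∀ (W : WeierstrassCurve ℚ) [W.IsElliptic] [W.IsGloballyMinimal], ¬ W.HasCM → W.analyticRank = 0 →
      GoodOrd W 2 → W.HasSurjectiveModNGaloisRep 2 → 0 < W.Δ →
      ∃ (P : geomTorsion W 2) (i : AlgebraicClosure ℚ) (n₀ : ℕ), P ≠ 0 ∧ i ^ 2 = -1 ∧
        ∀ κL : ZpExtension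
            ↥(IntermediateField.fixedField (MulAction.stabilizer (absoluteGaloisGroup ℚ) P) ⊔ IntermediateField.adjoin ℚ {i}) 2,
          κL.IsCyclotomic → TotallyRamifiedFrom κL n₀ ∧ classGroupPRank κL (n₀ + 1) = classGroupPRank κL n₀) :
    FineSelmerConjATwoOrdPosDisc := by
  intro W _ _ hcm hr hgo h2 hΔ κ hκ
  obtain ⟨P, i, n₀, hP, hi, hc⟩ := hcert W hcm hr hgo h2 hΔ
  exact conjA_two_of_fukudaCertificate_pointField_adjoin_I hLim2 hFuk W hP hi n₀ hc κ hκ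

end Summit.BirchSwinnertonDyer.BirchSwinnertonDyer.Theorems.SteinbergFibreAtTwo

end
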